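import Summits.QuantumFields.YangMills.Theorems.ForcedResponseSkewnessResponseLocalisationDefs
import Summits.QuantumFields.YangMills.Theorems.BalabanLadderNTCouplingSumRuleCumulant
import HarnessLib

/-!
# Crux `ResponseLocalisation` (stmt-QuantumFields-23615), line `birth`: registered stub `stub_split` (EXACT BOOKKEEPING)

Support file (`--supports stmt-QuantumFields-23615`) of the lead prover of route `ForcedResponseSkewness` (unit
`ym-line-frs-p1`).  For every compact `G` (Borel σ-algebra; simplicity is not used), every lattice representation `r`,
coupling `β`, odd torus `2L+1`, spacing `s` and Schwartz `v, f`: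

  `∂_c Q2_{c,L,s}(θv, v)|_{c=β} − Q3_{β,L,s}(f, θv, v) = Σ_{x ∈ box L} (1 − f(s x)) · respM_{β,L,s}(x)`,

`respM(x) = Σ_{y,z} θv(s y) v(s z) torusK3(x,y,z)` the response profile (`…ResponseLocalisationDefs`).  Proof: the tree's
third-order action sum rule `CouplingSumRule.hasDerivAt_torusCov_dens_coupling` (`∂_β Cov_T(A_x, A_y) = Σ_{z ∈ box L}
torusK3(x, y, z)`, itself `SkewResponse.hasDerivAt_torusCov_coupling` + the dictionary `−S_W = Σ_z A_z∘lift − 6N(2L+1)⁴`)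
smeared with `θv ⊗ v` gives `∂_c Q2 = Σ_{x,y,z} θv(s x) v(s y) torusK3(x,y,z)`; the cyclic symmetry
`torusK3(z,x,y) = torusK3(x,y,z)` (commutativity inside `torusE`) re-labels it as `Σ_x respM(x)`, and
`Q3(f,θv,v) = Σ_x f(s x) respM(x)` is the definition.  SIGN: Wilson's weight is `exp(−β S_W) = exp(+β Σ_z A_z + const)`, so
the identity holds with the `+` sign as registered.

Honest label: a bookkeeping stub of a conditional rung line (leaf R2a `BalabanLadder.NT`); nothing here bears on the
Yang–Mills mass gap, which is NOT proved by this.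
-/

set_option autoImplicit false

noncomputable section

namespace Summit.QuantumFields.YangMills.Cruxes.ResponseLocalisation.Birth

open MeasureTheory Filter Topology
open Literature.MathematicalPhysics.QuantumFieldTheory Literature.MathematicalPhysics.QuantumLattice
open Literature.Probability.LatticeModels
open Summit.QuantumFields.YangMills.Cruxes.OSLegsFromFemtoAndGap.DlrCollarTransfer
open Summit.QuantumFields.YangMills.Cruxes.NT.CouplingSumRule (hasDerivAt_torusCov_dens_coupling)

section Lattice

variable (G : Type) [Group G] [TopologicalSpace G] [IsTopologicalGroup G] [CompactSpace G]
  [MeasurableSpace G] [BorelSpace G] (r : LatticeRep G)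

/-- **Cyclic symmetry of the torus third cumulant**: `torusK3(z, x, y) = torusK3(x, y, z)`. [folklore] -/
theorem torusK3_cycl (β : ℝ) (L : ℕ) (x y z : Fin 4 → ℤ) :
    torusK3 G r β L z x y = torusK3 G r β L x y z := by
  unfold torusK3
  have e1 : (fun U : LGConfig 4 G => dens G r z U * dens G r x U * dens G r y U) =
      fun U => dens G r x U * dens G r y U * dens G r z U := by
    funext U; ring
  have e2 : (fun U : LGConfig 4 G => dens G r z U * dens G r y U) = fun U => dens G r y U * dens G r z U := by
    funext U; ring
  have e3 : (fun U : LGConfig 4 G => dens G r z U * dens G r x U) = fun U => dens G r x U * dens G r z U := by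
    funext U; ring
  rw [e1, e2, e3]
  ring

/-- **Smeared third-order sum rule**: `∂_c Q2_{c,L,s}(f, g)|_{c=β} = Σ_{x,y ∈ box L} f(s x) g(s y) Σ_{z ∈ box L} torusK3(x,y,z)`
(the tree's `hasDerivAt_torusCov_dens_coupling` summed against the test functions). [folklore] -/
theorem hasDerivAt_Q2_coupling_torusK3 (β : ℝ) (L : ℕ) (s : ℝ) (f g : SchwartzMap (EuclideanSpace ℝ (Fin 4)) ℝ) :
    HasDerivAt (fun c : ℝ => Q2 G r c L s f g)
      (∑ x ∈ box 4 L, ∑ y ∈ box 4 L, f (s • siteToE x) * g (s • siteToE y) *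
        ∑ z ∈ box 4 L, torusK3 G r β L x y z) β := by
  unfold Q2
  refine HasDerivAt.fun_sum fun x _ => HasDerivAt.fun_sum fun y _ => ?_
  exact (hasDerivAt_torusCov_dens_coupling G r β L x y).const_mul _

/-- **`∂_c Q2(f,g) = Σ_x respM`-form**: after the cyclic relabelling,
`∂_c Q2_{c,L,s}(θv, v)|_{c=β} = Σ_{x ∈ box L} respM_{β,L,s}(x)`. [folklore] -/
theorem deriv_Q2_coupling_eq_sum_respM (β : ℝ) (L : ℕ) (s : ℝ) (v : SchwartzMap (EuclideanSpace ℝ (Fin 4)) ℝ) :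
    deriv (fun c : ℝ => Q2 G r c L s (thetaTest 4 v) v) β = ∑ x ∈ box 4 L, respM G r β L s v x := by
  rw [(hasDerivAt_Q2_coupling_torusK3 G r β L s (thetaTest 4 v) v).deriv]
  unfold respM
  simp_rw [Finset.mul_sum]
  -- relabel `(x, y, z) ↦ (y, z, x)` on the right and use the cyclic symmetry
  symm
  calc ∑ x ∈ box 4 L, ∑ y ∈ box 4 L, ∑ z ∈ box 4 L,
        (thetaTest 4 v) (s • siteToE y) * v (s • siteToE z) * torusK3 G r β L x y z
      = ∑ x ∈ box 4 L, ∑ y ∈ box 4 L, ∑ z ∈ box 4 L,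
          (thetaTest 4 v) (s • siteToE y) * v (s • siteToE z) * torusK3 G r β L y z x := by
        refine Finset.sum_congr rfl fun x _ => Finset.sum_congr rfl fun y _ =>
          Finset.sum_congr rfl fun z _ => ?_
        rw [torusK3_cycl G r β L y z x]
    _ = ∑ y ∈ box 4 L, ∑ x ∈ box 4 L, ∑ z ∈ box 4 L,
          (thetaTest 4 v) (s • siteToE y) * v (s • siteToE z) * torusK3 G r β L y z x := Finset.sum_comm
    _ = ∑ y ∈ box 4 L, ∑ z ∈ box 4 L, ∑ x ∈ box 4 L,
          (thetaTest 4 v) (s • siteToE y) * v (s • siteToE z) * torusK3 G r β L y z x :=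
        Finset.sum_congr rfl fun y _ => Finset.sum_comm

/-- **`Q3(f, θv, v) = Σ_x f(s x) respM(x)`** (definitional bookkeeping). [folklore] -/
theorem Q3_eq_sum_mul_respM (β : ℝ) (L : ℕ) (s : ℝ) (v f : SchwartzMap (EuclideanSpace ℝ (Fin 4)) ℝ) :
    Q3 G r β L s f (thetaTest 4 v) v = ∑ x ∈ box 4 L, f (s • siteToE x) * respM G r β L s v x := by
  unfold Q3 respM
  refine Finset.sum_congr rfl fun x _ => ?_
  rw [Finset.mul_sum]
  refine Finset.sum_congr rfl fun y _ => ?_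
  rw [Finset.mul_sum]
  refine Finset.sum_congr rfl fun z _ => ?_
  ring

end Lattice

/-- **Registered stub `stub_split` of line `birth`** (crux `ResponseLocalisation`, stmt-QuantumFields-23615):
`∂_c Q2(θv,v) − Q3(f,θv,v) = Σ_x (1 − f(s x))·respM(x)`, for every compact simple `G` (Borel σ-algebra), `r`, `β`, `L`,
`s`, `v`, `f`. [folklore] -/
theorem stub_split : SplitSig := by
  intro G _ _ _ _ _
  letI : MeasurableSpace G := borel G
  haveI : BorelSpace G := ⟨rfl⟩
  intro r β L s v f
  rw [deriv_Q2_coupling_eq_sum_respM, Q3_eq_sum_mul_respM, ← Finset.sum_sub_distrib]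
  refine Finset.sum_congr rfl fun x _ => ?_
  ring

end Summit.QuantumFields.YangMills.Cruxes.ResponseLocalisation.Birth

end
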